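import Literature.ComputerArithmetic.Rump2006.CholeskyPositiveDefinite
import HarnessLib

/-!
# Sparse floating-point Cholesky: a-priori backward error with the SPARSITY counts
# (Rump, *Verified error bounds for sparse systems, Part I*, SIMAX 2026, Lemma 2.10 (2.15)–(2.16))

Topic `Literature/ComputerArithmetic`, namespace `Literature.ComputerArithmetic.Rump2026SparseI`.
Cell certnum (CERTIFIED-NUMERICS STACK, D-0105 (6)), layer L4: the soundness statement behind the
A-PRIORI `λ_min` floor of a verified SPARSE s.p.d. solve (`cap.ila.spd`: one shifted supernodal `LLᵀ` of
`fl(A − sI)` + an a-priori bound `α ≥ ‖A − sI − R̃ᵀR̃‖₂`; certnum lit-1 FACT F1-13).  The tree's dense file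
`Literature.ComputerArithmetic.Rump2006.CholeskyPositiveDefinite` proves Rump 2006 / Rump 2010 (10.58)
`|A − R̃ᵀR̃|_{ij} ≤ γ_{min(i,j)+2} (|R̃|ᵀ|R̃|)_{ij}` with the DENSE count `min(i, j)` and says so ("WHAT IS NOT
HERE: … the sparsity-aware counts `s(i,j)`").  For a sparse factor only the products `r̃_{ki} r̃_{kj}` with
BOTH factors nonzero are formed, so stage `(i, j)` subtracts `s(i,j) ≤ min(μ_i, μ_j) − 1` products
(`μ_i` = number of nonzeros in column `i` of `R̃`), and the constants become `γ_{Φ_{ij}}`,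
`Φ_{ij} = min(μ_i, μ_j) + 1` — for `n = 10⁶` and `μ ≈ 10²` four orders of magnitude below `γ_{n+1}`.
HONEST FRAMING: a typed and PROVED implication in the standard model; it certifies no engine output.

SOURCE.  S. M. Rump, *Verified error bounds for sparse systems, Part I: the splitting of a matrix into two
factors*, to appear in SIAM J. Matrix Anal. Appl. (2026) [Rump2026SparseI]; statement transcribed by
certnum-lit-1 from the author's version (`paper:url-16a6c3477380`, p0012 L41–p0013 L10; FACT lines
R2026-I / F1-13 of `pub/certnum/lit/FRESHNESS-CERTNUM.md`, 2026-08-26) — the key is in lit-1's private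
cache, so THIS seat quotes the FACT-line transcription, not its own page read:

> **Lemma 2.10.** Let symmetric `A ∈ 𝔽ⁿˣⁿ` be given and suppose the floating-point Cholesky
> decomposition runs to completion with factor `R̃`; let `μ_i` be the number of nonzero elements in
> column `i` of `R̃`, `u · max μ_k < 1`, `Φ_{ij} := min(μ_i, μ_j) + 1`, and `D` diagonal with
> `D_{kk} = (A_{kk}/(1 − Φ_{kk} u))^{1/2}`. Then for a nearest-rounding in the absence of underflow and
> overflow `ΔA := R̃ᵀR̃ − A` satisfies `‖ΔA‖₂ ≤ u ‖DΦD‖₂` (2.15). [Proof: `|ΔA|_{ij} ≤ φ_{ij} u (|R̃ᵀ||R̃|)_{ij}`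
> for `φ_{ij} := min(μ_i, μ_j) + 1` from [54, Thm 4.4], then Cauchy–Schwarz (2.16).]

## What is typed, and the deltas vs. print
* `SparseCholeskyRun u A R̃ S` — the tree's `Rump2006.CholeskyRun` (ANY evaluation order, fused
  operations allowed, standard model without underflow, square root stated root-free) with ONE change:
  stage `(i, j)`, `i ≤ j`, subtracts only the products `r̃_{ki} r̃_{kj}`, `k ∈ S i j ⊆ {k < i}` — an
  arbitrary index set supplied with the run — every other product `r̃_{ki} r̃_{kj}`, `k < i`, being ZERO
  (`zero`).  A symbolic sparse code uses the structural pattern; a numerical one the nonzero products;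
  both are instances.  The count is `s(i,j) := (S i j).card`.
* Per stage (`abs_offDiag_le`, `abs_diag_le`, `sum_mul_self_le_inv_pow`): Rump 2006 Lemma 2.1 / 2.2
  with `k = s(i,j)` — the tree's evaluation-tree kernels `CTree.abs_sub_sum_sub_mul_le`,
  `CTree.abs_sub_sum_sub_sq_le`, `CTree.sq_add_sum_le_inv_pow_mul` are count-agnostic and are REUSED.
* Entrywise (`abs_sub_transpose_mul_self_le`): `|A − R̃ᵀR̃|_{ij} ≤ γ_{Φ_{ij}} (|R̃|ᵀ|R̃|)_{ij}` for ANY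
  table `Φ` with `s(i,j) + 2 ≤ Φ_{ij}, Φ_{ji}` (`i ≤ j`) and `Φ_{ij} u < 1`; `card_add_two_le_min_colCount` /
  `abs_sub_transpose_mul_self_le_colCount`:
  if the run forms only products with both factors nonzero and the computed pivots are nonzero, Rump's
  `Φ_{ij} = min(μ_i, μ_j) + 1` qualifies (`s(i,j) ≤ min(μ_i, μ_j) − 1`).
  DELTA: the printed constant is the LINEAR `Φ_{ij}·u` of Rump–Jeannerod 2014 Thm 4.4; here it is
  `γ_{Φ_{ij}} = Φ_{ij}u/(1 − Φ_{ij}u)` (the tree's `γ`-model) — weaker by the factor `1/(1 − Φu)`.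
* Column norms (`sum_mul_self_le_inv_pow`, `sum_sq_le_of_le_sq`): `Σ_k r̃_{kj}² ≤ (1 − u)^{−(s(j,j)+2)} a_{jj}` (Rump 2006 (2.7)), so
  ANY `d_j ≥ 0` with `(1 − u)^{−(s(j,j)+2)} a_{jj} ≤ d_j²` majorises `‖r̃_j‖₂` — the `D` of (2.15) with the
  exponent form of the constant (a client takes an upward-rounded square root).
* Lemma 2.10 (`abs_quadForm_sub_le`): `|xᵀ(A − R̃ᵀR̃)x| ≤ |x|ᵀ M |x|`, `M_{ij} := γ_{Φ_{ij}} d_i d_j` — this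
  is (2.16) (Cauchy–Schwarz on `(|R̃|ᵀ|R̃|)_{ij} ≤ ‖r̃_i‖ ‖r̃_j‖`) written for the quadratic form; `‖M‖₂`
  bounds it, and `M = D Γ D` with `Γ_{ij} = γ_{Φ_{ij}}` is the typed counterpart of `u·DΦD`.
* Floors (`neg_mul_le_quadForm`, `quadForm_pos_of_shifted`): with the tree's COLLATZ lemma
  `Rump2006.quadForm_le_of_mulVec_le` (`M v ≤ c v`, `v > 0` ⇒ `|x|ᵀM|x| ≤ c xᵀx`, i.e. `‖M‖₂ ≤ c` by
  Perron–Frobenius — how `‖DΦD‖₂` is bounded in `O(nnz)` operations) one gets `xᵀAx ≥ −c·xᵀx`, and for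
  the shifted matrix `Ã` (`ã_{ij} = a_{ij}`, `ã_{jj} ≤ a_{jj} − c`) whose sparse Cholesky runs to completion
  with positive pivots: `xᵀAx > 0` for `x ≠ 0` (Rump 2006 Cor 2.4 with the sparse constant).
NOT HERE: underflow (`η`) terms; the linear-constant refinement; Cor 2.12 (Lange's `O(n)` evaluation of
`Φx` — an algorithmic identity, not needed for soundness: the client supplies ANY `v > 0`, `c` with
`M v ≤ c v` checked in rational or upward-rounded arithmetic); complex Hermitian data.

## Search record (TYPER LINT RULE)
`lean search 'SparseCholesky|columnCounts|Rump2026'`: no sparse Cholesky run model or count-aware bound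
in the tree (only the citations of [Rump2026SparseI] Thm 1.1 in `Analysis/Matrix/InertiaSigmaMin.lean`);
the dense file's docstring lists the sparsity counts under WHAT IS NOT HERE; certnum typed/INDEX-EXISTING
«F1-13 … needs a new run model» — this file is that model.

AI-produced formalisation (cell certnum, seat certnum-lean-1 gen 3, 2026-08-27).
-/

namespace Literature.ComputerArithmetic.Rump2026SparseI

open Finset Matrix
open Literature.ComputerArithmetic.Higham2002
open Literature.ComputerArithmetic.Rump2006

variable {K : Type*} [Field K] [LinearOrder K] [IsStrictOrderedRing K]

section Sparse

variable {u : K} {n : ℕ}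

/-- The list of products `r̃_{ki} r̃_{kj}`, `k ∈ S`, actually subtracted in stage `(i, j)` of a sparse
Cholesky (in the arbitrary order of `S.toList`; the evaluation tree may permute it).
[cite: Rump2026SparseI, Lemma 2.10 (proof: μ_i nonzeros per column)] -/
noncomputable def sprods (R : Matrix (Fin n) (Fin n) K) (S : Finset (Fin n)) (i j : Fin n) : List K :=
  S.toList.map fun k => R k i * R k j

omit [LinearOrder K] [IsStrictOrderedRing K] in
/-- The sparse stage subtracts `s(i,j) = |S|` products. [cite: Rump2026SparseI, Lemma 2.10] -/
theorem length_sprods (R : Matrix (Fin n) (Fin n) K) (S : Finset (Fin n)) (i j : Fin n) :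
    (sprods R S i j).length = S.card := by
  simp [sprods, Finset.length_toList]

omit [LinearOrder K] [IsStrictOrderedRing K] in
/-- The sum of the subtracted products is the `Finset` sum over `S`. [cite: Rump2026SparseI, Lemma 2.10] -/
theorem sum_sprods (R : Matrix (Fin n) (Fin n) K) (S : Finset (Fin n)) (i j : Fin n) :
    (sprods R S i j).sum = ∑ k ∈ S, R k i * R k j := by
  rw [sprods, Finset.sum_map_toList]

/-- **Sparse floating-point Cholesky executed to completion** (the tree's `Rump2006.CholeskyRun` with
sparsity): `R̃` upper triangular; stage `(i, j)`, `i ≤ j`, evaluates `a_{ij} − Σ_{k ∈ S i j} r̃_{ki} r̃_{kj}`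
by an arbitrary well-formed evaluation tree (`CTree`, any order, fused operations allowed, standard model
`fl(a ∘ b) = (a ∘ b)(1 + δ)`, `|δ| ≤ u`, no underflow) over an index set `S i j` of earlier rows `k < i`,
all OTHER products `r̃_{ki} r̃_{kj}` (`k < i`, `k ∉ S i j`) being zero — then divides by `r̃_{ii} ≠ 0`
(`i < j`) resp. takes the square root (`r̃_{jj}² = s̃(1 + δ)²`).
[cite: Rump2026SparseI, Lemma 2.10] [cite: Rump2006, (2.1) and (2.6)] -/
structure SparseCholeskyRun (u : K) (A R : Matrix (Fin n) (Fin n) K)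
    (S : Fin n → Fin n → Finset (Fin n)) : Prop where
  lower : ∀ i j : Fin n, j < i → R i j = 0
  subset : ∀ i j : Fin n, i ≤ j → ∀ k ∈ S i j, k < i
  zero : ∀ i j : Fin n, i ≤ j → ∀ k : Fin n, k < i → k ∉ S i j → R k i * R k j = 0
  offDiag : ∀ i j : Fin n, i < j → ∃ e : CTree K, e.WF u ∧ e.const = A i j ∧
    e.terms.Perm (sprods R (S i j) i j) ∧ R i i ≠ 0 ∧ |R i j - e.val / R i i| ≤ u * |e.val / R i i|
  diag : ∀ j : Fin n, ∃ e : CTree K, e.WF u ∧ e.const = A j j ∧ e.terms.Perm (sprods R (S j j) j j) ∧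
    ∃ δ : K, |δ| ≤ u ∧ R j j ^ 2 = e.val * (1 + δ) ^ 2

namespace SparseCholeskyRun

variable {A R : Matrix (Fin n) (Fin n) K} {S : Fin n → Fin n → Finset (Fin n)}

omit [IsStrictOrderedRing K] in
/-- The full inner product of columns `i ≤ j` of `R̃` is the sparse stage sum plus the pivot term:
`Σ_k r̃_{ki} r̃_{kj} = Σ_{k ∈ S i j} r̃_{ki} r̃_{kj} + r̃_{ii} r̃_{ij}` (rows `k > i` vanish by triangularity,
rows `k < i` outside `S i j` by sparsity). [cite: Rump2026SparseI, Lemma 2.10 (proof)] -/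
theorem sum_eq_sparse (h : SparseCholeskyRun u A R S)
    {i j : Fin n} (hij : i ≤ j) :
    ∑ k, R k i * R k j = (∑ k ∈ S i j, R k i * R k j) + R i i * R i j := by
  classical
  have hiS : i ∉ S i j := fun hi => lt_irrefl _ (h.subset i j hij i hi)
  have hsub : insert i (S i j) ⊆ univ := subset_univ _
  rw [← Finset.sum_subset hsub, Finset.sum_insert hiS, add_comm]
  intro k _ hk
  rw [Finset.mem_insert, not_or] at hk
  rcases lt_or_gt_of_ne hk.1 with hlt | hgt
  · exact h.zero i j hij k hlt hk.2
  · rw [h.lower k i hgt, zero_mul]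

/-- Stage `(i, j)`, `i < j`, with the SPARSE count `s = |S i j|`:
`|a_{ij} − Σ_k r̃_{ki} r̃_{kj}| ≤ γ_s Σ_{k ∈ S i j} |r̃_{ki} r̃_{kj}| + γ_{s+1} |r̃_{ii} r̃_{ij}|`
(Rump 2006 Lemma 2.1 / (2.3) with `k = s`). [cite: Rump2026SparseI, Lemma 2.10 (proof)] [cite: Rump2006, Lemma 2.1 and (2.3)] -/
theorem abs_offDiag_le (hu : 0 ≤ u) (h : SparseCholeskyRun u A R S) {i j : Fin n} (hij : i < j)
    (hk : (((S i j).card : K) + 1) * u < 1) :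
    |A i j - ∑ k, R k i * R k j| ≤
      gamma u (S i j).card * (∑ k ∈ S i j, |R k i * R k j|) +
        gamma u ((S i j).card + 1) * |R i i * R i j| := by
  obtain ⟨e, he, hc, hperm, hii, hy⟩ := h.offDiag i j hij
  have hlen : e.terms.length = (S i j).card := by rw [hperm.length_eq, length_sprods]
  have hsum : e.terms.sum = ∑ k ∈ S i j, R k i * R k j := by rw [hperm.sum_eq, sum_sprods]
  have habs : (e.terms.map (fun z => |z|)).sum = ∑ k ∈ S i j, |R k i * R k j| := by
    rw [(hperm.map _).sum_eq, sprods, List.map_map]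
    rw [Finset.sum_map_toList]
    rfl
  have main := CTree.abs_sub_sum_sub_mul_le hu he hii hy (by rw [hlen]; exact hk)
  rw [hlen, hc, hsum, habs] at main
  rw [h.sum_eq_sparse hij.le, ← sub_sub]
  exact main

/-- Stage `(j, j)` with the sparse count `s = |S j j|`:
`|a_{jj} − Σ_k r̃_{kj}²| ≤ γ_s Σ_{k ∈ S j j} r̃_{kj}² + γ_{s+2} r̃_{jj}²` (Rump 2006 Lemma 2.2 with `k = s`).
[cite: Rump2026SparseI, Lemma 2.10 (proof)] [cite: Rump2006, Lemma 2.2] -/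
theorem abs_diag_le (hu : 0 ≤ u) (h : SparseCholeskyRun u A R S) (j : Fin n)
    (hk : (((S j j).card : K) + 2) * u < 1) :
    |A j j - ∑ k, R k j * R k j| ≤
      gamma u (S j j).card * (∑ k ∈ S j j, R k j * R k j) +
        gamma u ((S j j).card + 2) * (R j j * R j j) := by
  obtain ⟨e, he, hc, hperm, δ, hδ, hy⟩ := h.diag j
  have hlen : e.terms.length = (S j j).card := by rw [hperm.length_eq, length_sprods]
  have hsum : e.terms.sum = ∑ k ∈ S j j, R k j * R k j := by rw [hperm.sum_eq, sum_sprods]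
  have habs : (e.terms.map (fun z => |z|)).sum = ∑ k ∈ S j j, R k j * R k j := by
    rw [(hperm.map _).sum_eq, sprods, List.map_map, Finset.sum_map_toList]
    exact sum_congr rfl fun k _ => abs_mul_self _
  have main := CTree.abs_sub_sum_sub_sq_le hu he hδ hy (by rw [hlen]; exact hk)
  rw [hlen, hc, hsum, habs, sq] at main
  rw [h.sum_eq_sparse le_rfl, ← sub_sub]
  exact main

/-- Stage `(j, j)`, second half of Rump 2006 Lemma 2.2 / (2.7) with the sparse count:
`Σ_k r̃_{kj}² ≤ (1 − u)^{−(s(j,j)+2)} a_{jj}` and `a_{jj} ≥ 0`.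
[cite: Rump2026SparseI, Lemma 2.10 (the diagonal D)] [cite: Rump2006, Lemma 2.2 and (2.7)] -/
theorem sum_mul_self_le_inv_pow (hu : 0 ≤ u) (hu1 : u < 1) (h : SparseCholeskyRun u A R S)
    (j : Fin n) : ∑ k, R k j * R k j ≤ ((1 - u) ^ ((S j j).card + 2))⁻¹ * A j j ∧ 0 ≤ A j j := by
  obtain ⟨e, he, hc, hperm, δ, hδ, hy⟩ := h.diag j
  have hlen : e.terms.length = (S j j).card := by rw [hperm.length_eq, length_sprods]
  have hsum : e.terms.sum = ∑ k ∈ S j j, R k j * R k j := by rw [hperm.sum_eq, sum_sprods]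
  have hz : ∀ z ∈ e.terms, 0 ≤ z := by
    intro z hz
    rw [hperm.mem_iff, sprods, List.mem_map] at hz
    obtain ⟨k, -, rfl⟩ := hz
    exact mul_self_nonneg _
  have main := CTree.sq_add_sum_le_inv_pow_mul hu hu1 he hδ hy hz
  rw [hlen, hc, hsum, sq] at main
  rw [h.sum_eq_sparse le_rfl, add_comm]
  exact main

/-- Column norms majorised (Rump 2006 (2.7), sparse count): any `d_j ≥ 0` with
`(1 − u)^{−(s(j,j)+2)} a_{jj} ≤ d_j²` satisfies `Σ_k r̃_{kj}² ≤ d_j²` — the diagonal `D` of (2.15) (a client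
takes `d_j` an upward-rounded square root). [cite: Rump2026SparseI, Lemma 2.10 (2.15)] [cite: Rump2006, (2.7)] -/
theorem sum_sq_le_of_le_sq (hu : 0 ≤ u) (hu1 : u < 1) (h : SparseCholeskyRun u A R S) (j : Fin n)
    {d : K} (hd : ((1 - u) ^ ((S j j).card + 2))⁻¹ * A j j ≤ d ^ 2) : ∑ k, R k j ^ 2 ≤ d ^ 2 := by
  calc ∑ k, R k j ^ 2 = ∑ k, R k j * R k j := sum_congr rfl fun k _ => sq _
    _ ≤ ((1 - u) ^ ((S j j).card + 2))⁻¹ * A j j := (h.sum_mul_self_le_inv_pow hu hu1 j).1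
    _ ≤ d ^ 2 := hd

/-- **Entrywise sparse backward error** (Rump 2026 I (2.16) in the `γ`-model): if `Φ` is any table with
`s(i,j) + 2 ≤ Φ_{ij}` and `s(i,j) + 2 ≤ Φ_{ji}` for `i ≤ j`, and `Φ_{ij} u < 1`, then
`|A − R̃ᵀR̃|_{ij} ≤ γ_{Φ_{ij}} (|R̃|ᵀ|R̃|)_{ij}` for ALL `i, j` (symmetric `A`).  Printed: `φ_{ij} u` with
`φ_{ij} = min(μ_i, μ_j) + 1`; see `card_add_two_le_min_colCount` for why that `Φ` qualifies.
[cite: Rump2026SparseI, Lemma 2.10 (2.16)] [cite: Rump2006, Theorem 2.3 (2.8)] -/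
theorem abs_sub_transpose_mul_self_le (hu : 0 ≤ u) (hA : Aᵀ = A) (h : SparseCholeskyRun u A R S)
    {Φ : Fin n → Fin n → ℕ} (hΦ : ∀ i j : Fin n, i ≤ j → (S i j).card + 2 ≤ Φ i j ∧ (S i j).card + 2 ≤ Φ j i)
    (hΦu : ∀ i j : Fin n, ((Φ i j : ℕ) : K) * u < 1) (i j : Fin n) :
    |A i j - (Rᵀ * R) i j| ≤ gamma u (Φ i j) * ∑ k, |R k i| * |R k j| := by
  -- the case `i ≤ j`, with any admissible constant index `m ≥ s(i,j) + 2`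
  have key : ∀ i j : Fin n, i ≤ j → ∀ m : ℕ, (S i j).card + 2 ≤ m → ((m : K)) * u < 1 →
      |A i j - (Rᵀ * R) i j| ≤ gamma u m * ∑ k, |R k i| * |R k j| := by
    intro i j hij m hm hmu
    have hs2 : (((S i j).card : K) + 2) * u < 1 := by
      have : ((S i j).card : K) + 2 ≤ m := by exact_mod_cast hm
      nlinarith
    have hRR : (Rᵀ * R) i j = ∑ k, R k i * R k j := by
      simp [Matrix.mul_apply, Matrix.transpose_apply]
    rw [hRR]
    have hγs : gamma u (S i j).card ≤ gamma u m := gamma_mono hu (by omega) hmu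
    have hγs1 : gamma u ((S i j).card + 1) ≤ gamma u m := gamma_mono hu (by omega) hmu
    have hγs2 : gamma u ((S i j).card + 2) ≤ gamma u m := gamma_mono hu (by omega) hmu
    have hsplit : ∑ k, |R k i| * |R k j| = (∑ k ∈ S i j, |R k i * R k j|) + |R i i * R i j| := by
      have h1 : ∑ k, |R k i| * |R k j| = ∑ k, |R k i * R k j| :=
        sum_congr rfl fun k _ => (abs_mul _ _).symm
      rw [h1]
      -- same support argument as `sum_eq_sparse`, for the absolute products
      classical
      have hiS : i ∉ S i j := fun hi => lt_irrefl _ (h.subset i j hij i hi)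
      rw [← Finset.sum_subset (subset_univ (insert i (S i j))), Finset.sum_insert hiS, add_comm]
      intro k _ hk
      rw [Finset.mem_insert, not_or] at hk
      rcases lt_or_gt_of_ne hk.1 with hlt | hgt
      · rw [h.zero i j hij k hlt hk.2, abs_zero]
      · rw [h.lower k i hgt, zero_mul, abs_zero]
    rcases hij.lt_or_eq with hlt | heq
    · have hb := h.abs_offDiag_le hu hlt (by nlinarith)
      rw [hsplit, mul_add]
      refine hb.trans (add_le_add ?_ ?_)
      · exact mul_le_mul_of_nonneg_right hγs (sum_nonneg fun k _ => abs_nonneg _)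
      · exact mul_le_mul_of_nonneg_right hγs1 (abs_nonneg _)
    · subst heq
      have hb := h.abs_diag_le hu i hs2
      have hsplit' : ∑ k, |R k i| * |R k i| = (∑ k ∈ S i i, R k i * R k i) + R i i * R i i := by
        rw [hsplit]
        congr 1
        · exact sum_congr rfl fun k _ => abs_mul_self _
        · exact abs_mul_self _
      rw [hsplit', mul_add]
      refine hb.trans (add_le_add ?_ ?_)
      · exact mul_le_mul_of_nonneg_right hγs
          (sum_nonneg fun k _ => mul_self_nonneg _)
      · exact mul_le_mul_of_nonneg_right hγs2 (mul_self_nonneg _)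
  rcases le_total i j with hij | hji
  · exact key i j hij (Φ i j) (hΦ i j hij).1 (hΦu i j)
  · -- `i ≥ j`: both sides are symmetric in `(i, j)`
    have hsymA : A i j = A j i := by
      have := congrFun (congrFun hA i) j
      rw [Matrix.transpose_apply] at this
      exact this.symm
    have hsymR : (Rᵀ * R) i j = (Rᵀ * R) j i := by
      simp only [Matrix.mul_apply, Matrix.transpose_apply]
      exact sum_congr rfl fun k _ => mul_comm _ _
    have hsymS : ∑ k, |R k i| * |R k j| = ∑ k, |R k j| * |R k i| :=
      sum_congr rfl fun k _ => mul_comm _ _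
    rw [hsymA, hsymR, hsymS]
    exact key j i hji (Φ i j) (hΦ j i hji).2 (hΦu i j)

/-- **Rump 2026 I Lemma 2.10, quadratic-form form of (2.15)–(2.16):** with `Φ` as above and nonnegative
column majorants `d_j`, `(1 − u)^{−(s(j,j)+2)} a_{jj} ≤ d_j²`, the backward error satisfies
`|xᵀ(A − R̃ᵀR̃)x| ≤ Σ_{ij} γ_{Φ_{ij}} d_i d_j |x_i| |x_j| = |x|ᵀ M |x|`, `M_{ij} := γ_{Φ_{ij}} d_i d_j` (Cauchy–Schwarz:
`(|R̃|ᵀ|R̃|)_{ij} ≤ ‖r̃_i‖₂ ‖r̃_j‖₂ ≤ d_i d_j`).  The printed `‖ΔA‖₂ ≤ u‖DΦD‖₂` is `≤ ‖M‖₂` with the linear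
constant. [cite: Rump2026SparseI, Lemma 2.10 (2.15)–(2.16)] -/
theorem abs_quadForm_sub_le (hu : 0 ≤ u) (hu1 : u < 1) (hA : Aᵀ = A) (h : SparseCholeskyRun u A R S)
    {Φ : Fin n → Fin n → ℕ} (hΦ : ∀ i j : Fin n, i ≤ j → (S i j).card + 2 ≤ Φ i j ∧ (S i j).card + 2 ≤ Φ j i)
    (hΦu : ∀ i j : Fin n, ((Φ i j : ℕ) : K) * u < 1) {d : Fin n → K} (hd0 : ∀ j, 0 ≤ d j)
    (hd : ∀ j, ((1 - u) ^ ((S j j).card + 2))⁻¹ * A j j ≤ d j ^ 2) (x : Fin n → K) :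
    |x ⬝ᵥ ((A - Rᵀ * R) *ᵥ x)| ≤ ∑ i, ∑ j, gamma u (Φ i j) * (d i * d j) * (|x i| * |x j|) := by
  -- Cauchy–Schwarz on the absolute column products
  have hcs : ∀ i j : Fin n, ∑ k, |R k i| * |R k j| ≤ d i * d j := by
    intro i j
    have h1 : (∑ k, |R k i| * |R k j|) ^ 2 ≤ (∑ k, |R k i| ^ 2) * ∑ k, |R k j| ^ 2 :=
      Finset.sum_mul_sq_le_sq_mul_sq _ _ _
    have hi : ∑ k, |R k i| ^ 2 ≤ d i ^ 2 := by
      rw [show ∑ k, |R k i| ^ 2 = ∑ k, R k i ^ 2 from sum_congr rfl fun k _ => sq_abs _]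
      exact h.sum_sq_le_of_le_sq hu hu1 i (hd i)
    have hj : ∑ k, |R k j| ^ 2 ≤ d j ^ 2 := by
      rw [show ∑ k, |R k j| ^ 2 = ∑ k, R k j ^ 2 from sum_congr rfl fun k _ => sq_abs _]
      exact h.sum_sq_le_of_le_sq hu hu1 j (hd j)
    have h2 : (∑ k, |R k i| * |R k j|) ^ 2 ≤ (d i * d j) ^ 2 := by
      rw [mul_pow]
      exact h1.trans (mul_le_mul hi hj (sum_nonneg fun k _ => sq_nonneg _) (sq_nonneg _))
    have h3 := abs_le_of_sq_le_sq h2 (mul_nonneg (hd0 i) (hd0 j))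
    rwa [abs_of_nonneg (sum_nonneg fun k _ => mul_nonneg (abs_nonneg _) (abs_nonneg _))] at h3
  have hγ0 : ∀ i j, 0 ≤ gamma u (Φ i j) := fun i j => gamma_nonneg hu (hΦu i j)
  have hentry : ∀ i j, |(A - Rᵀ * R) i j| ≤ gamma u (Φ i j) * (d i * d j) := by
    intro i j
    rw [Matrix.sub_apply]
    exact (h.abs_sub_transpose_mul_self_le hu hA hΦ hΦu i j).trans
      (mul_le_mul_of_nonneg_left (hcs i j) (hγ0 i j))
  have hexp : x ⬝ᵥ ((A - Rᵀ * R) *ᵥ x) = ∑ i, ∑ j, x i * ((A - Rᵀ * R) i j * x j) := by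
    simp only [dotProduct, mulVec, mul_sum]
  rw [hexp]
  calc |∑ i, ∑ j, x i * ((A - Rᵀ * R) i j * x j)|
      ≤ ∑ i, |∑ j, x i * ((A - Rᵀ * R) i j * x j)| := abs_sum_le_sum_abs _ _
    _ ≤ ∑ i, ∑ j, |x i * ((A - Rᵀ * R) i j * x j)| := sum_le_sum fun i _ => abs_sum_le_sum_abs _ _
    _ ≤ ∑ i, ∑ j, gamma u (Φ i j) * (d i * d j) * (|x i| * |x j|) := by
        refine sum_le_sum fun i _ => sum_le_sum fun j _ => ?_
        rw [abs_mul, abs_mul]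
        calc |x i| * (|(A - Rᵀ * R) i j| * |x j|) = |(A - Rᵀ * R) i j| * (|x i| * |x j|) := by ring
          _ ≤ _ := mul_le_mul_of_nonneg_right (hentry i j) (by positivity)

end SparseCholeskyRun

/-- The bounding matrix `M_{ij} = γ_{Φ_{ij}} d_i d_j` of `abs_quadForm_sub_le`, as a `Matrix` (symmetric
and entrywise nonnegative when `Φ` is symmetric). [cite: Rump2026SparseI, Lemma 2.10 (the matrix DΦD)] -/
def errMatrix (u : K) (Φ : Fin n → Fin n → ℕ) (d : Fin n → K) : Matrix (Fin n) (Fin n) K :=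
  fun i j => gamma u (Φ i j) * (d i * d j)

omit [IsStrictOrderedRing K] in
/-- The double sum of `abs_quadForm_sub_le` is the quadratic form of `errMatrix` at `|x|`.
[cite: Rump2026SparseI, Lemma 2.10] -/
theorem sum_sum_eq_quadForm_errMatrix (u : K)
    (Φ : Fin n → Fin n → ℕ) (d x : Fin n → K) :
    ∑ i, ∑ j, gamma u (Φ i j) * (d i * d j) * (|x i| * |x j|) =
      (fun i => |x i|) ⬝ᵥ (errMatrix u Φ d *ᵥ fun i => |x i|) := by
  simp only [dotProduct, mulVec, errMatrix, mul_sum]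
  exact sum_congr rfl fun i _ => sum_congr rfl fun j _ => by ring

namespace SparseCholeskyRun

variable {A R : Matrix (Fin n) (Fin n) K} {S : Fin n → Fin n → Finset (Fin n)}

/-- **A-priori `λ_min` floor from a sparse Cholesky run** (Rump 2006 Thm 2.3 with the sparse constant, via
COLLATZ): if `Φ` is symmetric and admissible, `d` majorises the column norms, and for some positive
weight vector `v` and constant `c` the bounding matrix satisfies `M v ≤ c v` (so `‖M‖₂ ≤ c`,
Perron–Frobenius — the tree's `Rump2006.quadForm_le_of_mulVec_le`), then `xᵀAx ≥ −c·xᵀx` for all `x`.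
[cite: Rump2026SparseI, Lemma 2.10 (2.15)] [cite: Rump2006, Theorem 2.3 and Lemma 2.6] -/
theorem neg_mul_le_quadForm (hu : 0 ≤ u) (hu1 : u < 1) (hA : Aᵀ = A) (h : SparseCholeskyRun u A R S)
    {Φ : Fin n → Fin n → ℕ} (hΦ : ∀ i j : Fin n, i ≤ j → (S i j).card + 2 ≤ Φ i j ∧ (S i j).card + 2 ≤ Φ j i)
    (hΦs : ∀ i j, Φ i j = Φ j i) (hΦu : ∀ i j : Fin n, ((Φ i j : ℕ) : K) * u < 1)
    {d : Fin n → K} (hd0 : ∀ j, 0 ≤ d j) (hd : ∀ j, ((1 - u) ^ ((S j j).card + 2))⁻¹ * A j j ≤ d j ^ 2)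
    {v : Fin n → K} (hv : ∀ i, 0 < v i) {c : K} (hc : ∀ i, (errMatrix u Φ d *ᵥ v) i ≤ c * v i)
    (x : Fin n → K) : -c * (x ⬝ᵥ x) ≤ x ⬝ᵥ (A *ᵥ x) := by
  have hq := h.abs_quadForm_sub_le hu hu1 hA hΦ hΦu hd0 hd x
  rw [sum_sum_eq_quadForm_errMatrix] at hq
  have hMs : (errMatrix u Φ d)ᵀ = errMatrix u Φ d := by
    ext i j
    simp only [Matrix.transpose_apply, errMatrix, hΦs i j, mul_comm (d i) (d j)]
  have hM0 : ∀ i j, 0 ≤ errMatrix u Φ d i j := fun i j =>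
    mul_nonneg (gamma_nonneg hu (hΦu i j)) (mul_nonneg (hd0 i) (hd0 j))
  have hcol := quadForm_le_of_mulVec_le hMs hM0 hv hc (fun i => |x i|)
  have habs : (fun i => |x i|) ⬝ᵥ (fun i => |x i|) = x ⬝ᵥ x := by
    simp only [dotProduct]
    exact sum_congr rfl fun i _ => abs_mul_abs_self _
  rw [habs] at hcol
  have hsplit : x ⬝ᵥ (A *ᵥ x) = (R *ᵥ x) ⬝ᵥ (R *ᵥ x) + x ⬝ᵥ ((A - Rᵀ * R) *ᵥ x) := by
    rw [sub_mulVec, dotProduct_sub, ← CholeskyRun.dotProduct_transpose_mul_self_mulVec]; ring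
  have hgram : 0 ≤ (R *ᵥ x) ⬝ᵥ (R *ᵥ x) := sum_nonneg fun i _ => mul_self_nonneg _
  rw [hsplit]
  linarith [neg_abs_le (x ⬝ᵥ ((A - Rᵀ * R) *ᵥ x))]

/-- Strict version for positive computed pivots: `xᵀAx > −c·xᵀx` for `x ≠ 0` (`R̃` is then nonsingular,
so `‖R̃x‖² > 0`). [cite: Rump2026SparseI, Lemma 2.10 (2.15)] [cite: Rump2006, Theorem 2.3] -/
theorem neg_mul_lt_quadForm (hu : 0 ≤ u) (hu1 : u < 1) (hA : Aᵀ = A) (h : SparseCholeskyRun u A R S)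
    {Φ : Fin n → Fin n → ℕ} (hΦ : ∀ i j : Fin n, i ≤ j → (S i j).card + 2 ≤ Φ i j ∧ (S i j).card + 2 ≤ Φ j i)
    (hΦs : ∀ i j, Φ i j = Φ j i) (hΦu : ∀ i j : Fin n, ((Φ i j : ℕ) : K) * u < 1)
    {d : Fin n → K} (hd0 : ∀ j, 0 ≤ d j) (hd : ∀ j, ((1 - u) ^ ((S j j).card + 2))⁻¹ * A j j ≤ d j ^ 2)
    {v : Fin n → K} (hv : ∀ i, 0 < v i) {c : K} (hc : ∀ i, (errMatrix u Φ d *ᵥ v) i ≤ c * v i)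
    (hpos : ∀ j, 0 < R j j) (x : Fin n → K) (hx : x ≠ 0) : -c * (x ⬝ᵥ x) < x ⬝ᵥ (A *ᵥ x) := by
  have hq := h.abs_quadForm_sub_le hu hu1 hA hΦ hΦu hd0 hd x
  rw [sum_sum_eq_quadForm_errMatrix] at hq
  have hMs : (errMatrix u Φ d)ᵀ = errMatrix u Φ d := by
    ext i j
    simp only [Matrix.transpose_apply, errMatrix, hΦs i j, mul_comm (d i) (d j)]
  have hM0 : ∀ i j, 0 ≤ errMatrix u Φ d i j := fun i j =>
    mul_nonneg (gamma_nonneg hu (hΦu i j)) (mul_nonneg (hd0 i) (hd0 j))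
  have hcol := quadForm_le_of_mulVec_le hMs hM0 hv hc (fun i => |x i|)
  have habs : (fun i => |x i|) ⬝ᵥ (fun i => |x i|) = x ⬝ᵥ x := by
    simp only [dotProduct]
    exact sum_congr rfl fun i _ => abs_mul_abs_self _
  rw [habs] at hcol
  have hsplit : x ⬝ᵥ (A *ᵥ x) = (R *ᵥ x) ⬝ᵥ (R *ᵥ x) + x ⬝ᵥ ((A - Rᵀ * R) *ᵥ x) := by
    rw [sub_mulVec, dotProduct_sub, ← CholeskyRun.dotProduct_transpose_mul_self_mulVec]; ring
  have hdet : R.det ≠ 0 := by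
    rw [Matrix.det_of_upperTriangular (fun i j hij => h.lower i j hij)]
    exact prod_ne_zero_iff.mpr fun j _ => (hpos j).ne'
  have hinj : Function.Injective R.mulVec :=
    Matrix.mulVec_injective_iff_isUnit.mpr
      ((Matrix.isUnit_iff_isUnit_det R).mpr (isUnit_iff_ne_zero.mpr hdet))
  have hRx : R *ᵥ x ≠ 0 := by
    intro h0
    apply hx
    apply hinj
    rw [h0, mulVec_zero]
  obtain ⟨i, hi⟩ := Function.ne_iff.mp hRx
  have hgram : 0 < (R *ᵥ x) ⬝ᵥ (R *ᵥ x) :=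
    sum_pos' (fun k _ => mul_self_nonneg _) ⟨i, mem_univ _, mul_self_pos.mpr hi⟩
  rw [hsplit]
  linarith [neg_abs_le (x ⬝ᵥ ((A - Rᵀ * R) *ᵥ x))]

end SparseCholeskyRun

/-! ### Rump's `Φ_{ij} = min(μ_i, μ_j) + 1` qualifies when only nonzero products are formed -/

/-- The number of nonzero entries of column `i` of `R̃` (`μ_i` of Lemma 2.10).
[cite: Rump2026SparseI, Lemma 2.10] -/
def colCount (R : Matrix (Fin n) (Fin n) K) (i : Fin n) : ℕ :=
  (univ.filter fun k => R k i ≠ 0).card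

omit [IsStrictOrderedRing K] in
/-- If stage `(i, j)`, `i ≤ j`, forms only products with BOTH factors nonzero (the numerical sparsity of
`R̃`), all its indices are `< i`, and the computed pivots `r̃_{ii}`, `r̃_{jj}` are nonzero, then
`s(i,j) + 2 ≤ min(μ_i, μ_j) + 1` — so Rump's `Φ_{ij} := min(μ_i, μ_j) + 1` is admissible in
`abs_sub_transpose_mul_self_le`. [cite: Rump2026SparseI, Lemma 2.10 (φ_ij := min(μ_i, μ_j) + 1)] -/
theorem card_add_two_le_min_colCount {R : Matrix (Fin n) (Fin n) K} {S : Finset (Fin n)} {i j : Fin n}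
    (hij : i ≤ j) (hS : ∀ k ∈ S, k < i ∧ R k i ≠ 0 ∧ R k j ≠ 0) (hii : R i i ≠ 0) (hjj : R j j ≠ 0) :
    S.card + 2 ≤ min (colCount R i) (colCount R j) + 1 := by
  classical
  have hi : S.card + 1 ≤ colCount R i := by
    have hsub : insert i S ⊆ univ.filter fun k => R k i ≠ 0 := by
      intro k hk
      rw [mem_insert] at hk
      rw [mem_filter]
      rcases hk with rfl | hk
      · exact ⟨mem_univ _, hii⟩
      · exact ⟨mem_univ _, (hS k hk).2.1⟩
    have hiS : i ∉ S := fun h => lt_irrefl _ (hS i h).1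
    have := card_le_card hsub
    rwa [card_insert_of_notMem hiS] at this
  have hj : S.card + 1 ≤ colCount R j := by
    have hsub : insert j S ⊆ univ.filter fun k => R k j ≠ 0 := by
      intro k hk
      rw [mem_insert] at hk
      rw [mem_filter]
      rcases hk with rfl | hk
      · exact ⟨mem_univ _, hjj⟩
      · exact ⟨mem_univ _, (hS k hk).2.2⟩
    have hjS : j ∉ S := fun h => absurd ((hS j h).1.trans_le hij) (lt_irrefl _)
    have := card_le_card hsub
    rwa [card_insert_of_notMem hjS] at this
  omega

/-- **Rump 2026 I (2.16) as printed (γ-model):** if every stage forms only products with both factors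
nonzero and the computed pivots are nonzero, then for symmetric `A`
`|A − R̃ᵀR̃|_{ij} ≤ γ_{min(μ_i, μ_j)+1} (|R̃|ᵀ|R̃|)_{ij}` with `μ_i = colCount R̃ i`, provided
`(min(μ_i, μ_j) + 1) u < 1`. [cite: Rump2026SparseI, Lemma 2.10 (2.16)] -/
theorem SparseCholeskyRun.abs_sub_transpose_mul_self_le_colCount {u : K} (hu : 0 ≤ u) {n : ℕ}
    {A R : Matrix (Fin n) (Fin n) K} {S : Fin n → Fin n → Finset (Fin n)} (hA : Aᵀ = A)
    (h : SparseCholeskyRun u A R S)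
    (hS : ∀ i j : Fin n, i ≤ j → ∀ k ∈ S i j, R k i ≠ 0 ∧ R k j ≠ 0) (hpiv : ∀ j, R j j ≠ 0)
    (hμu : ∀ i j : Fin n, (((min (colCount R i) (colCount R j) + 1 : ℕ)) : K) * u < 1) (i j : Fin n) :
    |A i j - (Rᵀ * R) i j| ≤
      gamma u (min (colCount R i) (colCount R j) + 1) * ∑ k, |R k i| * |R k j| := by
  refine h.abs_sub_transpose_mul_self_le hu hA (Φ := fun i j => min (colCount R i) (colCount R j) + 1)
    (fun i j hij => ?_) hμu i j
  have hc := card_add_two_le_min_colCount hij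
    (fun k hk => ⟨h.subset i j hij k hk, hS i j hij k hk⟩) (hpiv i) (hpiv j)
  exact ⟨hc, by rwa [min_comm] at hc⟩

/-! ### The a-priori criterion: sparse Cholesky of a shifted matrix -/

/-- **Positive definiteness from a shifted sparse Cholesky** (Rump 2006 Cor 2.4 / Rump 2010 §10.8.1 with
the sparse constant of Rump 2026 I Lemma 2.10): `A` symmetric, `Ã` symmetric with the same off-diagonal
and `ã_{jj} ≤ a_{jj} − c`; the sparse floating-point Cholesky of `Ã` runs to completion with positive
pivots; with an admissible symmetric `Φ`, column majorants `d` of the run and a Collatz witness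
`M v ≤ c v`, `v > 0` for `M_{ij} = γ_{Φ_{ij}} d_i d_j`: then `xᵀAx > 0` for every `x ≠ 0`.
[cite: Rump2026SparseI, Lemma 2.10 (2.15)] [cite: Rump2006, Corollary 2.4] [cite: Rump2010Verification, Section 10.8.1] -/
theorem quadForm_pos_of_shifted {u : K} (hu : 0 ≤ u) (hu1 : u < 1) {n : ℕ}
    {A At R : Matrix (Fin n) (Fin n) K} {S : Fin n → Fin n → Finset (Fin n)} (hAt : Atᵀ = At)
    (hrun : SparseCholeskyRun u At R S) (hpos : ∀ j, 0 < R j j)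
    {Φ : Fin n → Fin n → ℕ} (hΦ : ∀ i j : Fin n, i ≤ j → (S i j).card + 2 ≤ Φ i j ∧ (S i j).card + 2 ≤ Φ j i)
    (hΦs : ∀ i j, Φ i j = Φ j i) (hΦu : ∀ i j : Fin n, ((Φ i j : ℕ) : K) * u < 1)
    {d : Fin n → K} (hd0 : ∀ j, 0 ≤ d j) (hd : ∀ j, ((1 - u) ^ ((S j j).card + 2))⁻¹ * At j j ≤ d j ^ 2)
    {v : Fin n → K} (hv : ∀ i, 0 < v i) {c : K} (hc : ∀ i, (errMatrix u Φ d *ᵥ v) i ≤ c * v i)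
    (hoff : ∀ i j, i ≠ j → At i j = A i j) (hdiag : ∀ i, At i i ≤ A i i - c)
    (x : Fin n → K) (hx : x ≠ 0) : 0 < x ⬝ᵥ (A *ᵥ x) := by
  have h1 := hrun.neg_mul_lt_quadForm hu hu1 hAt hΦ hΦs hΦu hd0 hd hv hc hpos x hx
  have h2 := quadForm_shift_le hoff hdiag x
  linarith

/-- Over `ℝ`: the conclusion packaged as Mathlib's `Matrix.PosDef` (symmetry of `A` from that of `Ã`).
[cite: Rump2026SparseI, Lemma 2.10 (2.15)] [cite: Rump2006, Corollary 2.4] -/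
theorem posDef_of_shifted {u : ℝ} (hu : 0 ≤ u) (hu1 : u < 1) {n : ℕ}
    {A At R : Matrix (Fin n) (Fin n) ℝ} {S : Fin n → Fin n → Finset (Fin n)} (hAt : Atᵀ = At)
    (hrun : SparseCholeskyRun u At R S) (hpos : ∀ j, 0 < R j j)
    {Φ : Fin n → Fin n → ℕ} (hΦ : ∀ i j : Fin n, i ≤ j → (S i j).card + 2 ≤ Φ i j ∧ (S i j).card + 2 ≤ Φ j i)
    (hΦs : ∀ i j, Φ i j = Φ j i) (hΦu : ∀ i j : Fin n, ((Φ i j : ℕ) : ℝ) * u < 1)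
    {d : Fin n → ℝ} (hd0 : ∀ j, 0 ≤ d j) (hd : ∀ j, ((1 - u) ^ ((S j j).card + 2))⁻¹ * At j j ≤ d j ^ 2)
    {v : Fin n → ℝ} (hv : ∀ i, 0 < v i) {c : ℝ} (hc : ∀ i, (errMatrix u Φ d *ᵥ v) i ≤ c * v i)
    (hoff : ∀ i j, i ≠ j → At i j = A i j) (hdiag : ∀ i, At i i ≤ A i i - c) : A.PosDef := by
  have hA : A.IsHermitian := by
    rw [Matrix.IsHermitian, Matrix.conjTranspose_eq_transpose_of_trivial]
    ext i j
    rw [Matrix.transpose_apply]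
    by_cases hij : i = j
    · rw [hij]
    · have h1 := hoff j i (Ne.symm hij)
      have h2 := hoff i j hij
      have h3 : At j i = At i j := by
        have := congrFun (congrFun hAt i) j
        rw [Matrix.transpose_apply] at this
        exact this
      rw [← h1, h3, h2]
  refine Matrix.PosDef.of_dotProduct_mulVec_pos hA fun x hx => ?_
  rw [star_trivial]
  exact quadForm_pos_of_shifted hu hu1 hAt hrun hpos hΦ hΦs hΦu hd0 hd hv hc hoff hdiag x hx

/-! ### Append 2026-08-27 (certnum-lean-1 g3): page read, the quantitative floor, and the dense instance

PAGE READ (supersedes the «transcribed by certnum-lit-1» caveat of the module docstring, which stays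
byte-identical by the append-only policy): the author's version
`https://www.tuhh.de/ti3/paper/rump/sparselss_I_final.pdf` materialises as `paper:url-16a6c3477380`;
Lemma 2.10 = p0012 L41–47 + p0013 L2–10 (statement as quoted above, symbol for symbol), proof p0013
L14–37 («the number of nonzero products in the computation of `R̃_ij` does not exceed `min(μ_i, μ_j)`, plus
a square root in case `i = j`»; (2.16) by Cauchy–Schwarz; «`DΦD` is symmetric and positive, so
`‖DΦD‖₂` is … the Perron root» — the Collatz step used below), Remark 2.11 («the matrix `Φ` is a full
matrix» — so is `errMatrix`), Cor 2.12 p0013 L50–56.  One hypothesis is stated STRONGER than printed: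
`hΦu : Φ_{ij} u < 1` for all `i, j` (the printed lemma assumes `u · max μ_k < 1`; its `D_{kk}` presupposes
`Φ_{kk} u < 1`, which is what `hΦu` says on the diagonal). -/

/-- **The quantitative floor `λ_min(A) > s − c`** (the number a verified sparse s.p.d. solver reports):
`Ã` agrees with `A` off the diagonal and `ã_{jj} ≤ a_{jj} − s` (the shift `s` applied BEFORE factoring,
e.g. `Ã = fl∇(A − sI)`), the sparse Cholesky of `Ã` runs to completion with positive pivots, and the
Collatz witness bounds the run's error matrix by `c`: then `(s − c)·xᵀx < xᵀAx` for every `x ≠ 0`, i.e.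
`λ_min(A) > s − c` and, when `c < s`, `σ_min(A) = λ_min(A) > s − c > 0`.
[cite: Rump2026SparseI, Lemma 2.10 (2.15) with Thm 1.1 (1.4)] [cite: Rump2006, Corollary 2.4] -/
theorem sub_mul_lt_quadForm_of_shifted {u : K} (hu : 0 ≤ u) (hu1 : u < 1) {n : ℕ}
    {A At R : Matrix (Fin n) (Fin n) K} {S : Fin n → Fin n → Finset (Fin n)} (hAt : Atᵀ = At)
    (hrun : SparseCholeskyRun u At R S) (hpos : ∀ j, 0 < R j j)
    {Φ : Fin n → Fin n → ℕ} (hΦ : ∀ i j : Fin n, i ≤ j → (S i j).card + 2 ≤ Φ i j ∧ (S i j).card + 2 ≤ Φ j i)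
    (hΦs : ∀ i j, Φ i j = Φ j i) (hΦu : ∀ i j : Fin n, ((Φ i j : ℕ) : K) * u < 1)
    {d : Fin n → K} (hd0 : ∀ j, 0 ≤ d j) (hd : ∀ j, ((1 - u) ^ ((S j j).card + 2))⁻¹ * At j j ≤ d j ^ 2)
    {v : Fin n → K} (hv : ∀ i, 0 < v i) {c : K} (hc : ∀ i, (errMatrix u Φ d *ᵥ v) i ≤ c * v i)
    {s : K} (hoff : ∀ i j, i ≠ j → At i j = A i j) (hdiag : ∀ i, At i i ≤ A i i - s)
    (x : Fin n → K) (hx : x ≠ 0) : (s - c) * (x ⬝ᵥ x) < x ⬝ᵥ (A *ᵥ x) := by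
  have h1 := hrun.neg_mul_lt_quadForm hu hu1 hAt hΦ hΦs hΦu hd0 hd hv hc hpos x hx
  have h2 := quadForm_shift_le hoff hdiag x
  linarith

/-! ### Consistency with the dense model -/

omit [LinearOrder K] [IsStrictOrderedRing K] in
/-- The dense stage list `prods R i j` (all `k < i`) is a permutation of the sparse one over the full index
set `{k | k < i}`. [cite: Rump2006, (2.1)] [cite: Rump2026SparseI, Lemma 2.10] -/
theorem prods_perm_sprods (R : Matrix (Fin n) (Fin n) K) (i j : Fin n) :
    (prods R i j).Perm (sprods R (univ.filter (· < i)) i j) := by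
  classical
  have h1 : prods R i j = (List.ofFn fun k : Fin i.val => Fin.castLE i.isLt.le k).map
      (fun k => R k i * R k j) := by
    rw [prods, List.map_ofFn]; rfl
  rw [h1, sprods]
  refine List.Perm.map _ (List.perm_of_nodup_nodup_toFinset_eq ?_ (Finset.nodup_toList _) ?_)
  · exact List.nodup_ofFn.mpr (Fin.castLE_injective _)
  · ext k
    simp only [List.mem_toFinset, List.mem_ofFn, Finset.mem_toList, Finset.mem_filter,
      Finset.mem_univ, true_and]
    constructor
    · rintro ⟨m, rfl⟩
      exact Fin.mk_lt_of_lt_val m.isLt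
    · intro hk
      exact ⟨⟨k.val, hk⟩, Fin.ext rfl⟩

omit [IsStrictOrderedRing K] in
/-- **The dense model is an instance:** a `Rump2006.CholeskyRun u A R̃` (every product `k < i` subtracted)
is a `SparseCholeskyRun` with the full index sets `S i j = {k | k < i}` (so every theorem of this file
specialises to the dense one with `s(i,j) = i`). [cite: Rump2006, (2.1) and (2.6)] [cite: Rump2026SparseI, Lemma 2.10] -/
theorem SparseCholeskyRun.of_dense {A R : Matrix (Fin n) (Fin n) K} (h : CholeskyRun u A R) :
    SparseCholeskyRun u A R (fun i _ => univ.filter (· < i)) where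
  lower := h.lower
  subset := fun i j _ k hk => (Finset.mem_filter.mp hk).2
  zero := fun i j _ k hk hkS => (hkS (Finset.mem_filter.mpr ⟨Finset.mem_univ k, hk⟩)).elim
  offDiag := fun i j hij => by
    obtain ⟨e, he, hc, hp, hii, hy⟩ := h.offDiag i j hij
    exact ⟨e, he, hc, hp.trans (prods_perm_sprods R i j), hii, hy⟩
  diag := fun j => by
    obtain ⟨e, he, hc, hp, δ, hδ, hy⟩ := h.diag j
    exact ⟨e, he, hc, hp.trans (prods_perm_sprods R j j), δ, hδ, hy⟩

end Sparse

end Literature.ComputerArithmetic.Rump2026SparseI
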